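import Literature.MathematicalPhysics.QuantumFieldTheory.Balaban1983to89.B8HessianSupWitness

/-!
# B8 Theorem 8 — the non-abelian bilinear cross term of the gauge-transformed field sees the mixed
# lattice Hessian of `λ = Δ⁻¹f` (flat `ℤ²` model; companion to `B8HessianSupWitness` and `B8CurlGradHolonomy`)

Literature cell `b2b-balaban-b08` (paper sub-cell B08, gen 14), census GAPS C-B8-38 (AMENDMENT of C-B8-37),
DIVERGENCE D-b08-g14.4.  Tag [folklore]: elementary flat-lattice calculus on `ℤ²`; nothing of B8/B9 is asserted.

**Printed objects.**  B8 = Bałaban, *Spaces of regular gauge field configurations on a lattice and gauge fixing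
conditions*, CMP 99 (1985) 75–102: Theorem 8 p. 101 (= Theorem 2 p. 83 with the gauge condition
`R(U₀)D^{η*}_{U₀}A = f`, «f from the space R(U₀) satisfying the bound ∣f∣₍₋₂₎ < γ(α₀ + α₁)»), whose conclusion
includes (1.39) p. 83 «∣D^{η*}_{U₀}D^η_{U₀}A∣, ∣Δ^η_{U₀}A∣ < B₁(α₀ + α₁)(L^jη)^{−3} on Ω_j» for `U₁ = U′^{u⁻¹} = e^{iηA}`.
B9 = Bałaban, *Propagators for lattice gauge theories in a background field*, CMP 99 (1985) 389–434: the LINEAR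
covariant derivative (3.2′) p. 390, the linear exterior derivative (3.4) p. 391 (second form
`(DA)_{μν} = D_μA_ν − D_νA_μ`) and its adjoint (3.9) p. 392.

**What the sibling modules established (kernel).**  `B8HessianSupWitness` (C-B8-34): on `ℤ²` there are `ψ = v_K`
with `∣Δψ∣ ≤ 2`, vanishing block means and `(∂₁∂₂ψ)(0) ≥ log(K+1) − 5/2` (`scales_lower_bound`: `≥ k log L − 5/2`
for `K = L^k`) — the lattice Hessian of `Δ⁻¹f` is NOT bounded by `sup∣f∣` uniformly in the number of scales.
`B8CurlGradHolonomy` (C-B8-37): the (1.39) operators applied to a LINEAR pure-gauge increment `D_{U₀}λ` see only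
`λ`, `D_{U₀}λ` and the curvature of `U₀` (flat case: `curl ∘ grad = 0` exactly), never the Hessian of `λ`.

**What this module adds (the point C-B8-37 missed; C-B8-38).**  For NON-ABELIAN `G` the field `A″` of Theorem 8
differs from a Theorem-2 field `A` by MORE than a linear increment: if `u₈ = u₂·e^{iλ}` then, bond by bond,
`e^{iηA″(b)} = e^{iλ(b₋)} e^{iηA(b)} e^{−iR(U₀(b))λ(b₊)}`, and expanding to bilinear order
`ηA″ = ηA − ηD_{U₀}λ + i[λ, ηA] − (iη/2)[λ, D_{U₀}λ] + …`.  The (1.39) operator `D*D` is `−Δ⃗ + ∇ div*` on bond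
fields (flat lattice identity `dsd1_eq` / `dsd2_eq` below), and its `∇ div*` part applied to the bilinear term
`i[λ, A]` produces `Σ_μ [∂_ν∂*_μ λ, A_μ]` — the MIXED HESSIAN of `λ`, contracted with `A`.  In the simplest admissible
scenario (flat `U₀ = 1`; a Theorem-2 field `A` smooth at scale with `A(centre) ≈ a·e₁`, `∣a∣ ≈ α₁` — e.g. the
Theorem-2 output for the axial-gauge representative of the flat configuration `e^{iηa}` on `e₁`-bonds, whose block
averages saturate (1.35); modelled below as the CONSTANT field `a·e₁`, the derivatives of `A` only adding bounded
terms — source `f = φ·τ` with `[τ, a] ≠ 0`, `φ` the C-B8-34 profile scaled by `γ(α₀ + α₁)`; admissibility argued in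
GAPS C-B8-38, not certified), the bilinear term of `A″₁` is `ψ(x)·c` with the constant Lie-algebra element
`c = i[τ, a]` (`∣c∣ ~ α₁`) and `ψ = −Δ⁻¹φ` to leading order (corrections of relative size `O(α₁)`); entrywise this
is the scalar product field `C = (c·ψ, 0)` treated below, for which (kernel):
`(D*DC)₂(x) = c·(∂₁∂₂ψ)(x − e₁)` (`dsd2_prod`), `(D*DC)₁ = −c·∂*₂∂₂ψ` (`dsd1_prod`), hence at the site `e₁`
`(D*DC)₂(e₁) = c·(∂₁∂₂ψ)(0) ≥ c·(k log L − 5/2)` (`cross_term_lower_bound`) and NO constant bounds it over the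
admissible `ψ` (`no_uniform_cross_term_bound`), while the linear increment contributes nothing (`dsd_grad_eq_zero`).
Every other bilinear term vanishes in this scenario (`A` constant ⇒ `DA = 0`, `[∂λ, ∂A] = 0`; `λ` one-directional ⇒
`[λ, D_{U₀}λ] = 0`), so no cancellation is available at order `λ·A`: the natural size of `(D*DA″)(centre)` is
`≈ α₁γ(α₀ + α₁)·(k log L)·(L^kη)⁻³` against the printed `B₁(α₀ + α₁)(L^kη)⁻³` — k-uniformity of the (1.39) clause of
Theorem 8 under the printed hypothesis `∣f∣₍₋₂₎` ALONE is therefore NOT expected for non-abelian `G` (it is for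
abelian `G`, where `A″ = A − ∇λ` exactly and C-B8-37 applies verbatim).  With gen 1's added hypothesis
`∣D^η_{U₀}f∣₍₋₃₎` (G-B8-13) the source is Lipschitz at scale, the lattice Hessian of `Δ⁻¹f` is bounded (discrete
Schauder — standard, NOT kernel-checked here) and all cross terms are `O((α₀ + α₁)²)`: G-B8-13's conservative
bundling of (1.39) with that hypothesis is VINDICATED, and the sentence of C-B8-37 expecting (1.39) under the
printed hypothesis alone is withdrawn as abelian-only.

HONEST SCOPE.  Kernel-checked here: flat-lattice operator identities on `ℤ²` (`d`, `d*`, `d*d = −Δ + ∇div*`, product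
and gradient fields) and the unboundedness statement inherited from `B8HessianSupWitness`.  NOT kernel-checked:
the BCH expansion to bilinear order, the admissibility of the constant-`A` scenario under (1.33)–(1.35) (argued in
C-B8-38 from the printed conditions), that Theorem 8's `λ` equals `−Δ⁻¹f·τ` to leading order with corrections of
relative size `O(α₁)`, the discrete Schauder estimate under the added hypothesis, and anything about `d = 4`
(the `ℤ⁴` lift of C-B8-34, `no_uniform_sup_hessian_bound4`, transfers verbatim but is not restated).  A model
witness, not a refutation of a printed theorem: it LOCATES the term a proof of (1.39) for Theorem 8 must control
and shows the printed hypothesis does not control it in the model.  NOT summit progress.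
-/

namespace Literature.MathematicalPhysics.QuantumFieldTheory.Balaban1983to89.B8Thm8CrossTerm

open Literature.MathematicalPhysics.QuantumFieldTheory.Balaban1983to89.B8HessianSupWitness

/-! ## 1. Flat lattice calculus on bond fields of `ℤ²` (U₀ = 1, η = 1) -/

/-- [folklore] Forward difference along `e₁`: `(∂₁w)(x) = w(x + e₁) − w(x)` (same as `B8HessianSupWitness.d1` of
v1.2 §8; restated so that this module only needs the v1 interface `Site`, `lap`, `mixed`, `v`). -/
def fd1 (w : Site → ℚ) (x : Site) : ℚ := w (x.1 + 1, x.2) - w x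

/-- [folklore] Forward difference along `e₂`: `(∂₂w)(x) = w(x + e₂) − w(x)`. -/
def fd2 (w : Site → ℚ) (x : Site) : ℚ := w (x.1, x.2 + 1) - w x

/-- [folklore] The mixed second difference of `B8HessianSupWitness` is the iterated forward difference `∂₁∂₂`. -/
theorem mixed_eq_fd1_fd2 (w : Site → ℚ) (x : Site) : mixed w x = fd1 (fd2 w) x := by
  simp only [mixed, fd1, fd2]
  ring

/-- [folklore] Backward difference along `e₁`: `(∂*₁w)(x) = w(x) − w(x − e₁)`. -/
def b1 (w : Site → ℚ) (x : Site) : ℚ := w x - w (x.1 - 1, x.2)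

/-- [folklore] Backward difference along `e₂`: `(∂*₂w)(x) = w(x) − w(x − e₂)`. -/
def b2 (w : Site → ℚ) (x : Site) : ℚ := w x - w (x.1, x.2 - 1)

/-- [folklore] (B9 (3.4), second form, at `U₀ = 1`, `η = 1`.) The linear exterior derivative of a bond field
`C = (C₁, C₂)`: the plaquette function `(dC)(x) = (∂₁C₂)(x) − (∂₂C₁)(x)`. -/
def dB (C₁ C₂ : Site → ℚ) (x : Site) : ℚ := fd1 C₂ x - fd2 C₁ x

/-- [folklore] (B9 (3.9) at `U₀ = 1`.) First component of the `ℓ²`-adjoint `d*` of `dB` on plaquette functions: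
`(d*F)₁ = ∂*₂F` (from `Σ_x (dC)(x)F(x) = Σ_x [C₁(x)(∂*₂F)(x) − C₂(x)(∂*₁F)(x)]`, summation by parts). -/
def dS1 (F : Site → ℚ) (x : Site) : ℚ := b2 F x

/-- [folklore] Second component of the adjoint: `(d*F)₂ = −∂*₁F`. -/
def dS2 (F : Site → ℚ) (x : Site) : ℚ := -b1 F x

/-- [folklore] The (1.39) operator `D*D` at `U₀ = 1` on bond fields, first component. -/
def dsd1 (C₁ C₂ : Site → ℚ) : Site → ℚ := dS1 (dB C₁ C₂)

/-- [folklore] The (1.39) operator `D*D` at `U₀ = 1` on bond fields, second component. -/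
def dsd2 (C₁ C₂ : Site → ℚ) : Site → ℚ := dS2 (dB C₁ C₂)

/-- [folklore] Backward divergence of a bond field: `(div* C)(x) = (∂*₁C₁)(x) + (∂*₂C₂)(x)` (`= −d*` on bond → site
functions, B9 (3.8) at `U₀ = 1`). -/
def divS (C₁ C₂ : Site → ℚ) (x : Site) : ℚ := b1 C₁ x + b2 C₂ x

/-- [folklore] Pointwise summation-by-parts kernel for `dB`/`dS`: for every site `x`,
`(dC)(x)·F(x) − [C₁(x)(d*F)₁(x) + C₂(x)(d*F)₂(x)]` is a sum of two lattice divergences (telescoping terms), which is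
what makes `(dS1, dS2)` the `ℓ²`-adjoint of `dB` on finitely supported fields. -/
theorem dB_mul_sub_adjoint (C₁ C₂ F : Site → ℚ) (x : Site) :
    dB C₁ C₂ x * F x - (C₁ x * dS1 F x + C₂ x * dS2 F x)
      = (C₂ (x.1 + 1, x.2) * F x - C₂ x * F (x.1 - 1, x.2))
        - (C₁ (x.1, x.2 + 1) * F x - C₁ x * F (x.1, x.2 - 1)) := by
  simp only [dB, dS1, dS2, fd1, fd2, b1, b2]
  ring

/-- [folklore] **`D*D = −Δ + ∇div*` on the flat lattice**, first component:
`(d*dC)₁ = −ΔC₁ + ∂₁(div* C)` — the `∇div*` part is where second differences of BOTH components enter. -/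
theorem dsd1_eq (C₁ C₂ : Site → ℚ) (x : Site) :
    dsd1 C₁ C₂ x = -lap C₁ x + fd1 (divS C₁ C₂) x := by
  obtain ⟨m, n⟩ := x
  simp only [dsd1, dS1, dB, divS, lap, fd1, fd2, b1, b2, sub_add_cancel, add_sub_cancel_right]
  ring

/-- [folklore] `D*D = −Δ + ∇div*`, second component: `(d*dC)₂ = −ΔC₂ + ∂₂(div* C)`. -/
theorem dsd2_eq (C₁ C₂ : Site → ℚ) (x : Site) :
    dsd2 C₁ C₂ x = -lap C₂ x + fd2 (divS C₁ C₂) x := by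
  obtain ⟨m, n⟩ := x
  simp only [dsd2, dS2, dB, divS, lap, fd1, fd2, b1, b2, sub_add_cancel, add_sub_cancel_right]
  ring

/-! ## 2. The linear pure-gauge increment is invisible; the bilinear product term is not -/

/-- [folklore] (C-B8-37 in the flat model.) The plaquette field of a gradient vanishes: `d(∇ψ) = 0`. -/
theorem dB_grad_eq_zero (ψ : Site → ℚ) (x : Site) : dB (fd1 ψ) (fd2 ψ) x = 0 := by
  simp only [dB, fd1, fd2]
  ring

/-- [folklore] Hence BOTH components of `D*D(∇ψ)` vanish identically: the linear increment `−∇λ` of `A″` contributes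
nothing to the (1.39) quantity `D*DA″` in the flat model, whatever `λ` is. -/
theorem dsd_grad_eq_zero (ψ : Site → ℚ) (x : Site) :
    dsd1 (fd1 ψ) (fd2 ψ) x = 0 ∧ dsd2 (fd1 ψ) (fd2 ψ) x = 0 := by
  constructor
  · simp only [dsd1, dS1, b2, dB_grad_eq_zero, sub_self]
  · simp only [dsd2, dS2, b1, dB_grad_eq_zero, sub_self, neg_zero]

/-- [folklore] The bilinear cross term in product form `C = (c·ψ, 0)` (entrywise model of `i[λ, A]` with
`λ = ψ·τ`, `A = a·e₁` constant, `c = i[τ, a]`): its plaquette field is `−c·∂₂ψ`. -/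
theorem dB_prod (c : ℚ) (ψ : Site → ℚ) (x : Site) :
    dB (fun y => c * ψ y) (fun _ => 0) x = -(c * fd2 ψ x) := by
  simp only [dB, fd1, fd2, sub_self, zero_sub, mul_sub]

/-- [folklore] **The cross term sees the mixed Hessian**: `(D*DC)₂(x) = c·(∂₁∂₂ψ)(x − e₁)` for `C = (c·ψ, 0)`. -/
theorem dsd2_prod (c : ℚ) (ψ : Site → ℚ) (x : Site) :
    dsd2 (fun y => c * ψ y) (fun _ => 0) x = c * mixed ψ (x.1 - 1, x.2) := by
  obtain ⟨m, n⟩ := x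
  simp only [dsd2, dS2, b1, dB_prod, mixed, fd2, sub_add_cancel]
  ring

/-- [folklore] … and the pure second difference in the other component: `(D*DC)₁(x) = −c·(∂*₂∂₂ψ)(x)`. -/
theorem dsd1_prod (c : ℚ) (ψ : Site → ℚ) (x : Site) :
    dsd1 (fun y => c * ψ y) (fun _ => 0) x = -(c * (fd2 ψ x - fd2 ψ (x.1, x.2 - 1))) := by
  simp only [dsd1, dS1, b2, dB_prod]
  ring

/-! ## 3. The C-B8-34 profile: the cross term is unbounded over admissible sources -/

/-- [folklore] At the site `e₁ = (1, 0)` the cross term of the profile `v_K` is `c` times the divergent mixed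
Hessian `(∂₁∂₂v_K)(0)` of `B8HessianSupWitness`. -/
theorem cross_term_at_e1 (c : ℚ) (K : ℕ) :
    dsd2 (fun y => c * v K y) (fun _ => 0) (1, 0) = c * mixed (v K) (0, 0) := by
  rw [dsd2_prod]
  norm_num

/-- [folklore] Closed form for `K ≥ 2`: `(D*DC)₂(e₁) = c·(H_K − 5/2 + 2/K)` (`mixed_v_zero_eq`). -/
theorem cross_term_at_e1_eq (c : ℚ) (K : ℕ) (hK : 2 ≤ K) :
    dsd2 (fun y => c * v K y) (fun _ => 0) (1, 0) = c * (harmonic K - 5 / 2 + 2 / K) := by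
  rw [cross_term_at_e1, mixed_v_zero_eq K hK]

/-- [folklore] **Growth across scales** (`scales_lower_bound` transported): for `c ≥ 0`, `L ≥ 2`, `k ≥ 1` and the
profile with `K = L^k` (k block scales), `c·(k·log L − 5/2) ≤ (D*DC)₂(e₁)` — while `∣Δv_K∣ ≤ 2` (`abs_lap_v_le_two`)
and all block means of `v_K` vanish (`sum_v_box`), i.e. the source stays admissible with k-independent `∣f∣₍₋₂₎`. -/
theorem cross_term_lower_bound (c : ℚ) (hc : 0 ≤ c) (L k : ℕ) (hL : 2 ≤ L) (hk : 1 ≤ k) :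
    (c : ℝ) * ((k : ℝ) * Real.log L - 5 / 2)
      ≤ ((dsd2 (fun y => c * v (L ^ k) y) (fun _ => 0) (1, 0) : ℚ) : ℝ) := by
  rw [cross_term_at_e1]
  push_cast
  exact mul_le_mul_of_nonneg_left (scales_lower_bound L k hL hk) (by exact_mod_cast hc)

/-- [folklore] **No uniform bound on the cross term** (with `c = 1`): for every real `B` there is a finitely supported
`ψ : ℤ² → ℚ` with `∣Δψ∣ ≤ 2` everywhere whose cross term `(D*D(ψ, 0))₂(e₁)` exceeds `B` — whereas the linear
increment `∇ψ` of the same `ψ` has `D*D(∇ψ) = 0` (`dsd_grad_eq_zero`).  Inherited from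
`no_uniform_sup_hessian_bound`. -/
theorem no_uniform_cross_term_bound (B : ℝ) :
    ∃ K : ℕ, ∃ ψ : Site → ℚ,
      (∀ x, |lap ψ x| ≤ 2) ∧ (∀ x : Site, K ≤ x.1.natAbs + x.2.natAbs + 1 → ψ x = 0) ∧
        B < ((dsd2 (fun y => 1 * ψ y) (fun _ => 0) (1, 0) : ℚ) : ℝ) := by
  obtain ⟨K, w, hlap, hsupp, hB⟩ := no_uniform_sup_hessian_bound B
  refine ⟨K, w, hlap, hsupp, ?_⟩
  rw [dsd2_prod]
  norm_num
  exact hB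

/-- [folklore] Sanity (kernel, decidable arithmetic): for `K = 4`, `(D*D(v₄, 0))₂(e₁) = H₄ − 5/2 + 1/2 = 1/12`,
and the linear increment `∇v₄` gives `0` at the same site. -/
example : dsd2 (fun y => 1 * v 4 y) (fun _ => 0) (1, 0) = 1 / 12 ∧ dsd2 (fd1 (v 4)) (fd2 (v 4)) (1, 0) = 0 := by
  refine ⟨?_, (dsd_grad_eq_zero (v 4) (1, 0)).2⟩
  rw [cross_term_at_e1_eq 1 4 (by norm_num)]
  norm_num [harmonic_succ, harmonic_zero]

end Literature.MathematicalPhysics.QuantumFieldTheory.Balaban1983to89.B8Thm8CrossTerm
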